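import Literature.NumberTheory.EllipticCurves.Kato2004.ZetaSideInputs
import Literature.NumberTheory.EllipticCurves.Kato2004.DivisibilityInputsContragredient
import HarnessLib

/-!
# Kato 2004 (Astérisque 295), the ZETA SIDE of §17.13 at `(p)` — PRINT-EXACT twin of
# `Kato2004.ZetaSideInputs`, the dual Selmer data carrying their CONTRAGREDIENT `Λ`-structure
# (`D : W.SelmerDualData κ γ⁻¹`, `Y : W.FineSelmerDualData κ γ⁻¹` against the unchanged
# `I : Kato2004.IwasawaH1Data W p κ γ`); ONE construction fact `exists_zetaSideInputs_contra`, IMPLIED by the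
# tree's print-exact §17.13 package `exists_divisibilityInputs_fineQuotient_zeta_contra` (F1ᶜ)

Topic `NumberTheory/EllipticCurves`, sub-directory `Kato2004` (namespace = path).  Cell `bsd-smallim` (rung K6 of
`BirchSwinnertonDyer`, class X9, route `SmallImageMuTransfer`, crux `MuTransfer` = item 19629), seat `bsd-line-k6-p2`
gen 4 (D-0154 KEY (146) row 9, 2026-08-28).  Sibling of `Kato2004/ZetaSideInputs.lean` (this seat, gen 2), whose
structure, fact and four theorems it twins FIELD FOR FIELD in the manner of
`Kato2004/DivisibilityInputsContragredient.lean` (cell `bsd-stepL`, ticket T-ι-TWINS-1 of the ARM-P register of cell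
`bsd-cited`, RULING (650)/(651)).  Statements first; no instance beyond the structure's own bundled fields; no
notation; no attribute removed; nothing asserted; the sibling is NOT edited (D-0014).

## Why (honest framing; reading flag `Kato-1713-dual-action` of the ARM-P register)

`Kato2004.ZetaSideInputs W p f κ γ I D Y` — the sub-package of Kato's §17.13 inputs that a `μ`-transfer at `(p)`
consumes (the zeta-element construction with Thm. 12.5 (1), Thm. 12.6 + Ex. 13.3, Thm. 16.6 (2) + 17.5 read at
`(p)`, Prop. 17.11, (17.13.1) exactness at `P`, the fine quotient (14.9.3)) — binds, like its parent
`DivisibilityInputs`, the Poitou–Tate maps `P → X(E/ℚ_∞) → X₀(E/ℚ_∞)` of (17.13.1) as `Λ`-LINEAR maps into the tree's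
γ-keyed duals `D : W.SelmerDualData κ γ`, `Y : W.FineSelmerDualData κ γ` (`T` acting by PRE-composition with
`conj_γ`, `SelmerDualData.toDual_T_smul`) against the covariant `I : IwasawaH1Data W p κ γ` (`1 + T ↦ conj_γ`,
`IwasawaH1Data.proj_T_smul`).  Kato's (17.13.1) [p. 279] is "a sequence of `Λ`-modules" for `X(T)` "regarded as a
module over `Λ` in the natural way" [§17.3, p. 273]; local Tate duality is `Γ`-invariant (`⟨γa, γb⟩ = ⟨a, b⟩`), so
`a ↦ ⟨a, ·⟩` sends `γ_* a` to `⟨a, ·⟩ ∘ γ⁻¹_*`: the printed `Λ`-linear maps land in the duals with `T` acting as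
`x ↦ x ∘ conj_{γ⁻¹} − x`, i.e. the tree's `W.SelmerDualData κ γ⁻¹` / `W.FineSelmerDualData κ γ⁻¹` (Greenberg's `S^ι`).
The ARM-P audit (r02 ADDENDUM-8, R-48) therefore classified the γ-keyed packages STRONGER-THAN-PRINT-BY-ι and had the
print-exact twins of the three §17.13 packages typed (`DivisibilityInputsContra`, …, p604443); the END roads are
re-keyed by their owners (μ is ι-invariant: twist lemma T-TWIST-SEL-1).  THIS FILE is the twin of the fourth package,
the zeta side — so that the published input of crux 19629 can again be stated AT ITS TRUE SIZE (no `𝐇²`, no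
Euler-system divisibility theorem) AND print-exact: `exists_zetaSideInputs_contra` is WEAKER than F1ᶜ (implied by
forgetting fields, `exists_zetaSideInputs_contra_of_fineQuotient_zeta_contra`), hence weaker than print; never stronger.

## What is here

* `ZetaSideInputsContra W p f κ γ I D Y` — the sibling's hypothesis structure VERBATIM (fields `P, loc, toX, exact_P,
  col, col_injective, Z, Z_le_span, π, π_surjective, exact_toX_π, exists_notMem_smul_mem`, same names, types and
  docstrings) with the ONE change `D : W.SelmerDualData κ γ⁻¹`, `Y : W.FineSelmerDualData κ γ⁻¹`.
* `exists_zetaSideInputs_contra` — ONE construction fact, the sibling's `exists_zetaSideInputs` VERBATIM except for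
  the two dual binders; flag `Kato-1713-dual-action`; no `_holds` (Kato §§2–8, 12, 16, 17: size XL).
* THEOREMS (pure algebra, nothing asserted): `DivisibilityInputsContra.toZetaSideInputsContra` (forget 19 fields; the
  `(p)`-clause from `image_zeta_localized` at the height-one prime `(p)`), `exists_zetaSideInputs_contra_of_fineQuotient_zeta_contra`
  (F1ᶜ ⟹ this fact), and over a package `K : ZetaSideInputsContra …`: `K.exists_mem_Z_notMem` /
  `K.exists_isEulerSystemClass_notMem` (§6 (i) of the cell's `μ`-transfer — `𝐇¹`-side only, proofs token-for-token),
  `K.lengthAt_X_le_lengthAt_fine` (`length_(p) X ≤ length_(p) X₀` for the contragredient duals) and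
  `K.mu_eq_zero_of_lengthAt_fine_eq_zero` (`length_(p) X₀ = 0 ⟹ D.mu = 0` for the contragredient datum `D`; the
  consumer returns to a γ-keyed datum by T-TWIST-SEL-1 and the ι-fixed prime `(p)` — Summits-side, not here).

## What is NOT here

No edit of the sibling; no claim that `ZetaSideInputs` and `ZetaSideInputsContra` are equivalent (that would be the
unprinted ι-symmetry); no twist lemma; no `_holds`; nothing of `DivisibilityInputsContra` beyond the projection; the
consumer re-key (`Summits/…/Theorems/SmallImageMuTransferMuTransferOf…Contra.lean`) lives Summits-side.  BSD is not
advanced; the consumer's closes are conditional.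
-- TODO(general form): as in the siblings (newforms of weight `k ≥ 2`; all `Δ`-components).

## References (K. Kato, Astérisque 295 (2004); `[p. N]` = printed page, PDF page `N − 115` of the held text
`paper:doi-10-24033-ast-639`)

* Thm. 12.5 (1) [p. 221]; Thm. 12.6 [p. 222]; Ex. 13.3 [p. 225]; (14.9.3) [p. 240]; Thm. 16.6 (2) [p. 271]; §17.3
  [p. 273] ("`X(T) = Hom_{O_λ}(Sel_∞(T), F_λ/O_λ)`. We regard `X(T)` as a module over `Λ` in the natural way.");
  17.5 [p. 274]; Prop. 17.11 [p. 277]; §17.13 (17.13.1), (17.13.3) [p. 279] and p. 280.  [Kato2004Asterisque]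
* R. Greenberg, Adv. Stud. Pure Math. 17 (1989), pp. 101–102 ("If `S` is any `Λ`-module, we define `S^ι` as the
  `Λ`-module with the same underlying set as `S` but with `Λ` acting through `ι`.").  [Greenberg1989]
* R. Greenberg, V. Vatsal, Invent. Math. 142 (2000), §3 Remark 3.4 and Prop. 3.7.  [GreenbergVatsal2000]
* L. Washington, *Introduction to Cyclotomic Fields*, §13.2 (height-one primes of `Λ`).  [Washington1997]
* Tree: `Kato2004/ZetaSideInputs.lean` (the sibling; its module-docstring READING inherited here verbatim),
  `Kato2004/DivisibilityInputsContragredient.lean` (`DivisibilityInputsContra`, F1ᶜ, the flag's derivation),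
  `Kato2004/EulerSystemClasses.lean` (`IsEulerSystemClass`, `exists_mem_not_mem_of_le_span`), `IwasawaSelmer.lean`
  (`SelmerDualData.toDual_T_smul`), `Kato2004/IwasawaCohomology.lean` (`IwasawaH1Data.proj_T_smul`).
-/

noncomputable section

open scoped MatrixGroups ModularForm
open Field CongruenceSubgroup
open Literature.NumberTheory.GaloisRepresentations
open Literature.NumberTheory.EllipticCurves Literature.NumberTheory.EllipticCurves.ModularForms
open Literature.NumberTheory.EllipticCurves.Kato2004.EulerSystemValues
open Literature.NumberTheory.EllipticCurves.IwasawaAlgebra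

namespace Literature.NumberTheory.EllipticCurves.Kato2004

open Module

/-! ## The zeta-side package at `(p)`, duals contragredient -/

section Package

variable (W : WeierstrassCurve ℚ) [W.IsElliptic] [W.IsGloballyMinimal] (p : ℕ) [Fact p.Prime]
  [ContinuousSMul ℤ_[p] (W.tateModule p)] [Module.Free ℤ_[p] (W.tateModule p)]
  [Module.Finite ℤ_[p] (W.tateModule p)] {N : ℕ} [NeZero N] (f : CuspForm (Gamma0 N) 2)
  (κ : ZpExtension ℚ p) (γ : absoluteGaloisGroup ℚ)
  (I : IwasawaH1Data W p κ γ) (D : W.SelmerDualData κ γ⁻¹) (Y : W.FineSelmerDualData κ γ⁻¹)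

/-- **Kato's §17.13 inputs ON THE ZETA SIDE AT `(p)` — PRINT-EXACT twin of `Kato2004.ZetaSideInputs` (hypothesis
structure; nothing asserted).**  FIELD FOR FIELD the sibling `ZetaSideInputs W p f κ γ I D Y` (its field docstrings
apply verbatim: the abstract `P = 𝐇¹_loc(T(k))/𝐇¹_loc(T'(k))` of (17.13.3) with `loc : 𝐇¹ → P`, `toX : P → X` of
(17.13.1), exact at `P` (`p ≠ 2`); the injective Coleman map `col : P → Λ` of Prop. 17.11; the `Λ`-span `Z ≤ 𝐇¹` of the
integral zeta elements (Thm. 12.6) inside the span of GENUINE `Λ`-adic Euler-system classes (Ex. 13.3, tree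
`IsEulerSystemClass`); the fine quotient `π : X ↠ X₀`, exact after `toX` ((14.9.3)/(17.13.1)); and the ONE clause at
`(p)`: under `Irr(E[p])`, for `G₁ ∈ Λ` with `ι G₁ = L_p(E,T)`, some `s ∉ (p)` has `s·G₁ ∈ col(loc Z)` (Thm. 12.5 (1),
12.6, 16.6 (2), 17.5, Prop. 17.11, p. 280 read at `𝔭 = (p)`)), for the pinned covariant `I : IwasawaH1Data W p κ γ`
(`1 + T ↦ conj_γ`) and dual Selmer data `D : W.SelmerDualData κ γ⁻¹`, `Y : W.FineSelmerDualData κ γ⁻¹` in their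
CONTRAGREDIENT `Λ`-structure (`T` acting as `x ↦ x ∘ conj_{γ⁻¹} − x`) — the structure for which the Poitou–Tate maps
`P → X → X₀` of (17.13.1)/(14.9.3) are `Λ`-linear as printed (flag `Kato-1713-dual-action`).  The sub-package of
`Kato2004.DivisibilityInputsContra` consumed by a `μ`-argument at `(p)`.
[cite: Kato2004Asterisque, Thm. 12.5 (1) (p. 221), Thm. 12.6 (p. 222), Ex. 13.3 (p. 225), (14.9.3) (p. 240), Thm. 16.6 (2) (p. 271), §17.3 (p. 273), 17.5 (p. 274), Prop. 17.11 (p. 277), §17.13 (17.13.1) and (17.13.3) (p. 279) and p. 280]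
[cite: Greenberg1989, §0 pp. 101–102 (the Λ-module S^ι, ι(γ) = γ⁻¹)] [cite: GreenbergVatsal2000, §3 Remark 3.4 and Prop. 3.7] -/
structure ZetaSideInputsContra where
  /-- `P = 𝐇¹_loc(T(k))/𝐇¹_loc(T'(k))` ((17.13.3)), abstract. -/
  P : Type
  [addCommGroupP : AddCommGroup P]
  [moduleP : _root_.Module (IwasawaAlgebra p) P]
  /-- (17.13.1): `𝐇¹ → P` (localisation at `p` followed by the quotient by `𝐇¹_loc(T')`). -/
  loc : I.H →ₗ[IwasawaAlgebra p] P
  /-- (17.13.1): `P → 𝔛 = X(E/ℚ_∞)` (contragredient `Λ`-structure on the dual). -/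
  toX : P →ₗ[IwasawaAlgebra p] D.X
  /-- (17.13.1) with (17.13.3), `p ≠ 2`: exactness at `P`. -/
  exact_P : Function.Exact loc toX
  /-- Prop. 17.11: the Coleman map `𝔏_η` induces `P → Λ` … -/
  col : P →ₗ[IwasawaAlgebra p] IwasawaAlgebra p
  /-- Prop. 17.11: … which is injective. -/
  col_injective : Function.Injective col
  /-- Thm. 12.6: the `Λ`-span `Z ⊂ 𝐇¹(T)` of the integral zeta elements (8.1.3)/(8.11), projected to
  the `Δ`-trivial component. -/
  Z : Submodule (IwasawaAlgebra p) I.H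
  /-- Thm. 12.6 with Ex. 13.3: `Z` lies in the `Λ`-span of genuine `Λ`-adic Euler-system classes. -/
  Z_le_span : Z ≤ Submodule.span (IwasawaAlgebra p) {s : I.H | IsEulerSystemClass W p κ γ I s}
  /-- (14.9.3)/(17.13.1): the fine quotient `X(E/ℚ_∞) → X₀(E/ℚ_∞)` (dual of `Sel₀ ⊆ Sel`; both duals
  contragredient) … -/
  π : D.X →ₗ[IwasawaAlgebra p] Y.X
  /-- … is surjective … -/
  π_surjective : Function.Surjective π
  /-- … and exact after `P → X` (`Coker(P → 𝔛) = X₀`). -/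
  exact_toX_π : Function.Exact toX π
  /-- Thm. 12.5 (1), Thm. 12.6, Thm. 16.6 (2), 17.5, Prop. 17.11 and p. 280 read at `𝔭 = (p)`: under
  `Irr(E[p])`, for `G₁ ∈ Λ` with `ι G₁ = L_p(E,T)`, some `s ∉ (p)` has `s·G₁ ∈ col(loc Z)` (witness
  `s = T^m` through `T^m z_{γ₀} ∈ Z`, `col(loc z_{γ₀}) = u·G₁`, `u ∈ Λˣ`). -/
  exists_notMem_smul_mem : W.HasIrreducibleModPGaloisRep p → ∀ G₁ : IwasawaAlgebra p,
    iwasawaToPowerSeries p G₁ = padicLFunction f (unitRoot W p : ℚ_[p]) →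
      ∃ s : IwasawaAlgebra p, s ∉ augIdealP p ∧ s * G₁ ∈ Submodule.map (col ∘ₗ loc) Z

attribute [instance] ZetaSideInputsContra.addCommGroupP ZetaSideInputsContra.moduleP

end Package

/-! ## The named fact: the zeta-side package exists, duals contragredient (Kato's construction, §§8, 12, 16, 17 for `f_E`) -/

/-- **Kato 2004, Thm. 12.5 (1), Thm. 12.6 with Ex. 13.3, Thm. 16.6 (2), 17.5, Prop. 17.11, §17.13 (17.13.1)/(17.13.3)
and (14.9.3) for `T ≅ T_pE(−1)`, `k = 2`: the zeta-side package EXISTS on the pinned triple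
`(𝐇¹_Γ(T_pW), X(E/ℚ_∞), X₀(E/ℚ_∞))` with BOTH duals in their CONTRAGREDIENT `Λ`-structure.**  VERBATIM the sibling
`exists_zetaSideInputs` (same outer binders: `E/ℚ` on a globally minimal model with the structure facts of `T_pW` as
instance binders, every ODD good ordinary `p`, the cyclotomic `κ` with topological generator `γ` matching the
cyclotomic variable, every newform `f` of `W`, every `I`) except `D : W.SelmerDualData κ γ⁻¹`,
`Y : W.FineSelmerDualData κ γ⁻¹` and the conclusion `Nonempty (ZetaSideInputsContra W p f κ γ I D Y)` — the structure
for which Kato's (17.13.1) is `Λ`-linear as printed (§17.3: `X(T)` "as a module over `Λ` in the natural way"; flag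
`Kato-1713-dual-action`; the sibling is this package composed with `ι` on the dual side, ARM-P R-48).  A CONSTRUCTION
fact, WEAKER than the tree's print-exact §17.13 package `exists_divisibilityInputs_fineQuotient_zeta_contra` (F1ᶜ),
which implies it by forgetting fields (`exists_zetaSideInputs_contra_of_fineQuotient_zeta_contra`); hence weaker than
print; never stronger; nothing asserted; no `_holds` (size XL).
[cite: Kato2004Asterisque, Thm. 12.5 (1) (p. 221), Thm. 12.6 (p. 222), Ex. 13.3 (p. 225), (14.9.3) (p. 240), Thm. 16.6 (2) (p. 271), §17.3 (p. 273), 17.5 (p. 274), Prop. 17.11 (p. 277), §17.13 (pp. 279–280)]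
[cite: Greenberg1989, §0 pp. 101–102 (S^ι)] [cite: GreenbergVatsal2000, §3 Remark 3.4 and Prop. 3.7] -/
def exists_zetaSideInputs_contra : Prop :=
  ∀ (W : WeierstrassCurve ℚ) [W.IsElliptic] [W.IsGloballyMinimal] (p : ℕ) [Fact p.Prime]
    [ContinuousSMul ℤ_[p] (W.tateModule p)] [Module.Free ℤ_[p] (W.tateModule p)]
    [Module.Finite ℤ_[p] (W.tateModule p)] {N : ℕ} [NeZero N] (f : CuspForm (Gamma0 N) 2)
    (κ : ZpExtension ℚ p) (γ : absoluteGaloisGroup ℚ),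
    p ≠ 2 → IsOrdinaryAt W p → κ.IsCyclotomic → κ.IsTopGenerator γ → IsCyclotomicVariable p γ →
    IsNewformOf W f →
    ∀ (I : IwasawaH1Data W p κ γ) (D : W.SelmerDualData κ γ⁻¹) (Y : W.FineSelmerDualData κ γ⁻¹),
      Nonempty (ZetaSideInputsContra W p f κ γ I D Y)

/-! ## Theorems: the print-exact full package projects onto the print-exact zeta side; F1ᶜ ⟹ the fact -/

section Projection

variable {W : WeierstrassCurve ℚ} [W.IsElliptic] [W.IsGloballyMinimal] {p : ℕ} [Fact p.Prime]
  [ContinuousSMul ℤ_[p] (W.tateModule p)] [Module.Free ℤ_[p] (W.tateModule p)]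
  [Module.Finite ℤ_[p] (W.tateModule p)] {N : ℕ} [NeZero N] {f : CuspForm (Gamma0 N) 2}
  {κ : ZpExtension ℚ p} {γ : absoluteGaloisGroup ℚ}
  {I : IwasawaH1Data W p κ γ} {D : W.SelmerDualData κ γ⁻¹} {Y : W.FineSelmerDualData κ γ⁻¹}

/-- **`DivisibilityInputsContra` ⟹ `ZetaSideInputsContra` (forget 19 fields)** — the sibling's
`DivisibilityInputs.toZetaSideInputs` VERBATIM for the contragredient structures: given the full print-exact §17.13
package `K`, a fine quotient `π` (surjective, exact after `K.toX`) and the Thm. 12.6 span clause, the zeta-side package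
with the SAME `P, loc, toX, col, Z`; its `(p)`-clause is the first half of `K.image_zeta_localized` at the height-one
prime `(p)` (`isPrime_augIdealP_holds`, `height_augIdealP_holds`). [cite: Kato2004Asterisque, §17.13 (pp. 279–280)] -/
def DivisibilityInputsContra.toZetaSideInputsContra (K : DivisibilityInputsContra W p f κ γ I D)
    (π : D.X →ₗ[IwasawaAlgebra p] Y.X) (hπs : Function.Surjective π) (hπ : Function.Exact K.toX π)
    (hZ : K.Z ≤ Submodule.span (IwasawaAlgebra p) {s : I.H | IsEulerSystemClass W p κ γ I s}) :
    ZetaSideInputsContra W p f κ γ I D Y where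
  P := K.P
  loc := K.loc
  toX := K.toX
  exact_P := K.exact_P
  col := K.col
  col_injective := K.col_injective
  Z := K.Z
  Z_le_span := hZ
  π := π
  π_surjective := hπs
  exact_toX_π := hπ
  exists_notMem_smul_mem := fun hirr G₁ hG₁ ↦ by
    obtain ⟨s, hs, hsG, -⟩ := K.image_zeta_localized hirr G₁ hG₁
      ⟨augIdealP p, isPrime_augIdealP_holds p⟩ (by exact height_augIdealP_holds p)
    exact ⟨s, hs, hsG⟩

/-- **F1ᶜ ⟹ the contragredient zeta-side fact**: `exists_divisibilityInputs_fineQuotient_zeta_contra` (file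
`DivisibilityInputsContragredient`) implies `exists_zetaSideInputs_contra`, by
`DivisibilityInputsContra.toZetaSideInputsContra`. [cite: Kato2004Asterisque, Thm. 12.6 (p. 222) and §17.13 (pp. 279–280)] -/
theorem exists_zetaSideInputs_contra_of_fineQuotient_zeta_contra
    (h : exists_divisibilityInputs_fineQuotient_zeta_contra) : exists_zetaSideInputs_contra := by
  intro W _ _ p _ _ _ _ N _ f κ γ hp hord hκ hγ hγ' hf I D Y
  obtain ⟨K, π, hπs, hπ, hZ⟩ := h W p f κ γ hp hord hκ hγ hγ' hf I D Y
  exact ⟨K.toZetaSideInputsContra π hπs hπ hZ⟩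

end Projection

/-! ## Theorems over a contragredient zeta-side package: §6 (i) of the `μ`-transfer and the bookkeeping at `(p)` -/

section Consequences

variable {W : WeierstrassCurve ℚ} [W.IsElliptic] [W.IsGloballyMinimal] {p : ℕ} [Fact p.Prime]
  [ContinuousSMul ℤ_[p] (W.tateModule p)] [Module.Free ℤ_[p] (W.tateModule p)]
  [Module.Finite ℤ_[p] (W.tateModule p)] {N : ℕ} [NeZero N] {f : CuspForm (Gamma0 N) 2}
  {κ : ZpExtension ℚ p} {γ : absoluteGaloisGroup ℚ}
  {I : IwasawaH1Data W p κ γ} {D : W.SelmerDualData κ γ⁻¹} {Y : W.FineSelmerDualData κ γ⁻¹}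

omit [NeZero N] in
/-- **§6 (i): `μ(L_p(E)) = 0 ⟹` the zeta submodule is not inside `p·𝐇¹`** (contragredient package; the sibling's
`ZetaSideInputs.exists_mem_Z_notMem` token-for-token — the statement involves `𝐇¹`, `P` and `Λ` only).  If `E[p]` is
irreducible, `ι G₁ = L_p(E,T)` and `G₁ ∉ (p)`, then some `z ∈ K.Z` is not in `p·𝐇¹_Γ(T_pW)`.
[cite: Kato2004Asterisque, Thm. 12.6 (p. 222) and §17.13 (p. 280)] -/
theorem ZetaSideInputsContra.exists_mem_Z_notMem (K : ZetaSideInputsContra W p f κ γ I D Y)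
    (hirr : W.HasIrreducibleModPGaloisRep p) {G₁ : IwasawaAlgebra p}
    (hG₁ : iwasawaToPowerSeries p G₁ = padicLFunction f (unitRoot W p : ℚ_[p]))
    (hμ : G₁ ∉ augIdealP p) :
    ∃ z ∈ K.Z, z ∉ augIdealP p • (⊤ : Submodule (IwasawaAlgebra p) I.H) := by
  obtain ⟨s, hs, hsG⟩ := K.exists_notMem_smul_mem hirr G₁ hG₁
  by_contra hcon
  push Not at hcon
  have hZ : K.Z ≤ augIdealP p • (⊤ : Submodule (IwasawaAlgebra p) I.H) := fun z hz ↦ hcon z hz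
  have hsub : Submodule.map (K.col ∘ₗ K.loc) K.Z ≤
      (augIdealP p • ⊤ : Submodule (IwasawaAlgebra p) (IwasawaAlgebra p)) :=
    (Submodule.map_mono hZ).trans (by rw [Submodule.map_smul'']; exact Submodule.smul_mono le_rfl le_top)
  have htop : (augIdealP p • ⊤ : Submodule (IwasawaAlgebra p) (IwasawaAlgebra p)) = augIdealP p := by
    rw [Ideal.smul_eq_mul, Ideal.mul_top]
  have hsG' : s * G₁ ∈ augIdealP p := by rw [← htop]; exact hsub hsG
  rcases (isPrime_augIdealP_holds p).mem_or_mem hsG' with h | h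
  · exact hs h
  · exact hμ h

omit [NeZero N] in
/-- **§6 (i) with Thm. 12.6 / Ex. 13.3: `μ(L_p(E)) = 0 ⟹` some GENUINE `Λ`-adic Euler-system class is not divisible
by `p` in `𝐇¹_Γ(T_pW)`** (contragredient package; the sibling's `ZetaSideInputs.exists_isEulerSystemClass_notMem`
token-for-token), from `exists_mem_Z_notMem` and the span clause `Z_le_span`.
[cite: Kato2004Asterisque, Thm. 12.6 (p. 222), Ex. 13.3 (p. 225) and §17.13 (p. 280)] -/
theorem ZetaSideInputsContra.exists_isEulerSystemClass_notMem (K : ZetaSideInputsContra W p f κ γ I D Y)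
    (hirr : W.HasIrreducibleModPGaloisRep p) {G₁ : IwasawaAlgebra p}
    (hG₁ : iwasawaToPowerSeries p G₁ = padicLFunction f (unitRoot W p : ℚ_[p]))
    (hμ : G₁ ∉ augIdealP p) :
    ∃ s : I.H, IsEulerSystemClass W p κ γ I s ∧
      s ∉ augIdealP p • (⊤ : Submodule (IwasawaAlgebra p) I.H) := by
  obtain ⟨z, hz, hzp⟩ := K.exists_mem_Z_notMem hirr hG₁ hμ
  obtain ⟨s, hs, hsp⟩ := exists_mem_not_mem_of_le_span K.Z_le_span hz hzp
  exact ⟨s, hs, hsp⟩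

omit [NeZero N] in
/-- **(14.9.3)/(17.13.1) bookkeeping at `𝔭 = (p)` for the CONTRAGREDIENT duals, under `Irr(E[p])` and
`μ(L_p(E)) = 0`: `length_(p) X(E/ℚ_∞) ≤ length_(p) X₀(E/ℚ_∞)`** (the sibling's
`ZetaSideInputs.lengthAt_X_le_lengthAt_fine` token-for-token: `(Λ/col(loc Z))_(p) = 0`, `P/loc Z ↪ Λ/col(loc Z)`,
`P/loc Z → X → X₀` exact at `X`). [cite: Kato2004Asterisque, (14.9.3) (p. 240), Prop. 17.11 (p. 277) and §17.13 (pp. 279–280)] -/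
theorem ZetaSideInputsContra.lengthAt_X_le_lengthAt_fine (K : ZetaSideInputsContra W p f κ γ I D Y)
    (hirr : W.HasIrreducibleModPGaloisRep p) {G₁ : IwasawaAlgebra p}
    (hG₁ : iwasawaToPowerSeries p G₁ = padicLFunction f (unitRoot W p : ℚ_[p]))
    (hμ : G₁ ∉ augIdealP p) (𝔭 : PrimeSpectrum (IwasawaAlgebra p)) (h𝔭 : 𝔭.asIdeal = augIdealP p) :
    lengthAt (IwasawaAlgebra p) D.X 𝔭 ≤ lengthAt (IwasawaAlgebra p) Y.X 𝔭 := by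
  obtain ⟨s, hs, hsG⟩ := K.exists_notMem_smul_mem hirr G₁ hG₁
  set LZ : Submodule (IwasawaAlgebra p) K.P := Submodule.map K.loc K.Z with hLZ
  set M : Ideal (IwasawaAlgebra p) := Submodule.map K.col LZ with hM
  have hM_eq : Submodule.map (K.col ∘ₗ K.loc) K.Z = M := by
    rw [hM, hLZ, Submodule.map_comp]
  have hsGM : s * G₁ ∈ M := hM_eq ▸ hsG
  have hnot : ¬ M ≤ 𝔭.asIdeal := fun hle ↦ by
    rcases 𝔭.isPrime.mem_or_mem (hle hsGM) with h | h
    · exact hs (h𝔭 ▸ h)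
    · exact hμ (h𝔭 ▸ h)
  have hΛM : lengthAt (IwasawaAlgebra p) (IwasawaAlgebra p ⧸ M) 𝔭 = 0 :=
    lengthAt_quotient_eq_zero_of_not_le hnot
  have hPLZ : lengthAt (IwasawaAlgebra p) (K.P ⧸ LZ) 𝔭 = 0 := by
    refine le_antisymm ?_ bot_le
    rw [← hΛM]
    refine lengthAt_le_of_injective (Submodule.mapQ LZ M K.col fun y hy ↦ ⟨y, hy, rfl⟩) ?_ 𝔭
    rw [← LinearMap.ker_eq_bot, Submodule.ker_mapQ, hM,
      Submodule.comap_map_eq_of_injective K.col_injective, Submodule.mkQ_map_self]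
  have hle : LZ ≤ LinearMap.ker K.toX := by
    rintro _ ⟨z, -, rfl⟩
    exact (K.exact_P (K.loc z)).mpr ⟨z, rfl⟩
  let f' : (K.P ⧸ LZ) →ₗ[IwasawaAlgebra p] D.X := LZ.liftQ K.toX hle
  have hf' : Function.Exact f' K.π := by
    rw [LinearMap.exact_iff, Submodule.range_liftQ]
    exact LinearMap.exact_iff.mp K.exact_toX_π
  calc lengthAt (IwasawaAlgebra p) D.X 𝔭
      ≤ lengthAt (IwasawaAlgebra p) (K.P ⧸ LZ) 𝔭 + lengthAt (IwasawaAlgebra p) Y.X 𝔭 :=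
        lengthAt_le_add_of_exact f' K.π hf' 𝔭
    _ = lengthAt (IwasawaAlgebra p) Y.X 𝔭 := by rw [hPLZ, zero_add]

omit [NeZero N] in
/-- **`length_(p) X₀(E/ℚ_∞) = 0 ⟹ μ(X(E/ℚ_∞)) = 0` for the CONTRAGREDIENT datum `D : W.SelmerDualData κ γ⁻¹`**, under
`Irr(E[p])` and one `p`-adic unit coefficient of `L_p(f, α)` (the sibling's
`ZetaSideInputs.mu_eq_zero_of_lengthAt_fine_eq_zero` token-for-token: GV Prop. 3.7 integrality `ι G₁ = L_p`, the
certificate `G₁ ∉ (p)`, `length_(p) X ≤ length_(p) X₀ = 0`, `μ = length_(p)`).  The consumer returns to a γ-keyed datum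
by the twist lemma T-TWIST-SEL-1 and the ι-fixed prime `(p)` (μ is ι-invariant) — Summits-side.
[cite: Kato2004Asterisque, (14.9.3) (p. 240) and §17.13 (p. 280)] [cite: GreenbergVatsal2000, Prop. 3.7] -/
theorem ZetaSideInputsContra.mu_eq_zero_of_lengthAt_fine_eq_zero (K : ZetaSideInputsContra W p f κ γ I D Y)
    (hirr : W.HasIrreducibleModPGaloisRep p) {G₁ : IwasawaAlgebra p}
    (hG₁ : iwasawaToPowerSeries p G₁ = padicLFunction f (unitRoot W p : ℚ_[p]))
    (hcert : ∃ n : ℕ, ‖PowerSeries.coeff n (padicLFunction f (unitRoot W p : ℚ_[p]))‖ = 1)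
    (𝔭 : PrimeSpectrum (IwasawaAlgebra p)) (h𝔭 : 𝔭.asIdeal = augIdealP p)
    (hY : lengthAt (IwasawaAlgebra p) Y.X 𝔭 = 0) : D.mu = 0 := by
  have hμ : G₁ ∉ augIdealP p := not_mem_augIdealP_of_norm_coeff_eq_one hG₁ hcert
  have hX : lengthAt (IwasawaAlgebra p) D.X 𝔭 = 0 :=
    le_antisymm ((K.lengthAt_X_le_lengthAt_fine hirr hG₁ hμ 𝔭 h𝔭).trans hY.le) bot_le
  change muInvariant p D.X = 0
  rw [muInvariant_eq_toNat_lengthAt p D.X 𝔭 h𝔭, hX]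
  rfl

end Consequences

end Literature.NumberTheory.EllipticCurves.Kato2004

end
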